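import Mathlib
import Summits.CriticalPhenomena.PercolationContinuityZ3.Theorems.PercNearOneGluingNoHeavyLowerTailKnQuestion8AntitheticHalfCone

/-!
# `NoHeavyLowerTail` (crux stmt-CriticalPhenomena-4575), antipodal-Kleitman programme: the CONE–HALF DICTIONARY, converse direction —
# property A of the upper half implies antipodal Kleitman (so AK ⟺ property A of any half)

Support file (seat `prim-ineq-gen-7` gen 50; `--supports stmt-CriticalPhenomena-4575`, closed crux).  No `sorry`, no definitions; standard axioms.
Memo: `run/shared/lean/prim/prim-ineq-gen-7/FINDING-HG-g49.md` §1 (dictionary), gen-50 notes.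

SETTING (as in `AntitheticHalfCone.half_cone`).  `X` a finite partial order, `ι` an order-reversing involution, `L` a HALF (a down-set with
`x ∈ L ↔ ι x ∉ L`); the UPPER HALF `{x ∉ L}` carries the polarity `a ~ b :⟺ ι a ≤ b`.  PROPERTY A of the upper half: `0 ≤ ∑_{x ∉ L} u x * v x` for
all `u, v` monotone on the upper half and polar-admissible there.  ANTIPODAL KLEITMAN (functional form, unit weights, as in
`AntitheticProduct.antipodalKleitman_prod`): `0 ≤ ∑ x, f x * (g x − g (ι x))` for all monotone `f, g : X → ℝ`.
* `AntitheticConeHalf.cone_half` — property A of the upper half ⟹ AK.  PROOF: for monotone `f, g` put `u := f − f ∘ ι`, `v := g − g ∘ ι`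
  (restricted to the upper half they are monotone — `f ∘ ι` is antitone — and polar-admissible: `ι a ≤ b` gives `f (ι a) ≤ f b` and, applying `ι`,
  `f (ι b) ≤ f a`); pairing the summands at `x ∉ L` and `ι x ∈ L` gives `∑_X f (g − g∘ι) = ∑_{x ∉ L} u x * v x ≥ 0`.
* `AntitheticConeHalf.ak_iff_half_cone` — with gen 49's `half_cone`: AK ⟺ property A of the upper half (for every half `L`).
Use: THEOREM M (`AntitheticRowPairing.matchable_product`, property A of products with a matchable factor) now yields AK of the glued involution
poset in the functional form, closing the formal gap noted in FINDING-HG-g49 §9(4).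
-/

namespace Summit.CriticalPhenomena.PercolationContinuityZ3.Theorems

open Finset

namespace AntitheticConeHalf

variable {X : Type*} [Fintype X] [DecidableEq X] [PartialOrder X]

/-- **Property A of the upper half implies antipodal Kleitman.**  `ι` an order-reversing involution of the finite poset `X`, `L` a half
(down-set with `x ∈ L ↔ ι x ∉ L`).  If `0 ≤ ∑ x ∈ univ.filter (· ∉ L), u x * v x` for all `u, v : X → ℝ` monotone on `{x ∉ L}` and
polar-admissible there (`a ∉ L → b ∉ L → ι a ≤ b → 0 ≤ u a + u b`), then `0 ≤ ∑ x, f x * (g x - g (ι x))` for all monotone `f, g`. [this work] -/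
theorem cone_half (ι : X → X) (hιι : Function.Involutive ι) (hanti : ∀ x y : X, x ≤ y → ι y ≤ ι x)
    (L : Finset X) (hL : ∀ x, x ∈ L ↔ ι x ∉ L)
    (hA : ∀ u v : X → ℝ,
      (∀ x y, x ∉ L → y ∉ L → x ≤ y → u x ≤ u y) → (∀ x y, x ∉ L → y ∉ L → x ≤ y → v x ≤ v y) →
      (∀ a b, a ∉ L → b ∉ L → ι a ≤ b → 0 ≤ u a + u b) → (∀ a b, a ∉ L → b ∉ L → ι a ≤ b → 0 ≤ v a + v b) →
      0 ≤ ∑ x ∈ univ.filter (fun x => x ∉ L), u x * v x)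
    (f g : X → ℝ) (hf : Monotone f) (hg : Monotone g) :
    0 ≤ ∑ x, f x * (g x - g (ι x)) := by
  have hLι : ∀ x, x ∉ L → ι x ∈ L := fun x hx => by
    have h := hL (ι x)
    rw [hιι x] at h
    by_contra h'
    exact h' (h.mpr hx)
  -- the odd parts
  set u : X → ℝ := fun x => f x - f (ι x) with hu_def
  set v : X → ℝ := fun x => g x - g (ι x) with hv_def
  have mono : ∀ (w : X → ℝ), Monotone w → ∀ x y, x ∉ L → y ∉ L → x ≤ y → w x - w (ι x) ≤ w y - w (ι y) := by
    intro w hw x y _ _ hxy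
    have h1 := hw hxy
    have h2 := hw (hanti x y hxy)
    linarith
  have adm : ∀ (w : X → ℝ), Monotone w → ∀ a b, a ∉ L → b ∉ L → ι a ≤ b → 0 ≤ (w a - w (ι a)) + (w b - w (ι b)) := by
    intro w hw a b _ _ hab
    have h1 := hw hab
    have hba : ι b ≤ a := by
      have := hanti (ι a) b hab
      rwa [hιι a] at this
    have h2 := hw hba
    linarith
  have key := hA u v (mono f hf) (mono g hg) (adm f hf) (adm g hg)
  -- ∑_X f (g - g∘ι) = ∑_{x ∉ L} f (g - gι) + ∑_{x ∈ L} f (g - gι), and the second sum, reindexed by ι, is ∑_{x ∉ L} f(ιx) (g(ιx) - g x)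
  have e1 : ∑ x, f x * (g x - g (ι x)) =
      ∑ x ∈ univ.filter (fun x => x ∈ L), f x * (g x - g (ι x)) + ∑ x ∈ univ.filter (fun x => x ∉ L), f x * (g x - g (ι x)) :=
    (Finset.sum_filter_add_sum_filter_not _ _ _).symm
  have e2 : ∑ x ∈ univ.filter (fun x => x ∈ L), f x * (g x - g (ι x)) =
      ∑ x ∈ univ.filter (fun x => x ∉ L), f (ι x) * (g (ι x) - g x) := by
    refine Finset.sum_nbij' ι ι ?_ ?_ ?_ ?_ ?_
    · intro x hx
      have hx' : x ∈ L := (Finset.mem_filter.1 hx).2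
      exact Finset.mem_filter.2 ⟨Finset.mem_univ _, (hL x).1 hx'⟩
    · intro y hy
      have hy' : y ∉ L := (Finset.mem_filter.1 hy).2
      exact Finset.mem_filter.2 ⟨Finset.mem_univ _, hLι y hy'⟩
    · intro x _; exact hιι x
    · intro y _; exact hιι y
    · intro x _
      rw [hιι x]
  have e3 : ∑ x ∈ univ.filter (fun x => x ∉ L), u x * v x =
      ∑ x ∈ univ.filter (fun x => x ∉ L), f (ι x) * (g (ι x) - g x) + ∑ x ∈ univ.filter (fun x => x ∉ L), f x * (g x - g (ι x)) := by
    rw [← Finset.sum_add_distrib]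
    refine Finset.sum_congr rfl (fun x _ => ?_)
    simp only [hu_def, hv_def]
    ring
  rw [e1, e2, ← e3]
  exact key

/-- **AK ⟺ property A of the upper half** (the cone–half dictionary in both directions: `cone_half` above and gen 49's
`AntitheticHalfCone.half_cone`).  Hypotheses: `ι` an order-reversing involution, `L` a half (down-set, `x ∈ L ↔ ι x ∉ L`). [this work] -/
theorem ak_iff_half_cone (ι : X → X) (hιι : Function.Involutive ι) (hanti : ∀ x y : X, x ≤ y → ι y ≤ ι x)
    (L : Finset X) (hL : ∀ x, x ∈ L ↔ ι x ∉ L) (hdown : ∀ x y, x ≤ y → y ∈ L → x ∈ L) :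
    (∀ f g : X → ℝ, Monotone f → Monotone g → 0 ≤ ∑ x, f x * (g x - g (ι x))) ↔
    (∀ u v : X → ℝ,
      (∀ x y, x ∉ L → y ∉ L → x ≤ y → u x ≤ u y) → (∀ x y, x ∉ L → y ∉ L → x ≤ y → v x ≤ v y) →
      (∀ a b, a ∉ L → b ∉ L → ι a ≤ b → 0 ≤ u a + u b) → (∀ a b, a ∉ L → b ∉ L → ι a ≤ b → 0 ≤ v a + v b) →
      0 ≤ ∑ x ∈ univ.filter (fun x => x ∉ L), u x * v x) := by
  constructor
  · intro hAK u v hu hv hpu hpv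
    exact AntitheticHalfCone.half_cone ι hιι hanti hAK L hL hdown u v hu hv hpu hpv
  · intro hA f g hf hg
    exact cone_half ι hιι hanti L hL hA f g hf hg

end AntitheticConeHalf

end Summit.CriticalPhenomena.PercolationContinuityZ3.Theorems
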